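import Summits.AtomisticToContinuum.Crystallization.Theorems.ChessboardParticlePlanesPeriodicWindowsStubLayerData
import Summits.AtomisticToContinuum.Crystallization.Theorems.PhononSlackCertificatesPeriodicGivenLayeredLayerCake4

/-!
# Crux `PeriodicWindows` (stmt-AtomisticToContinuum-3240), line `dense-laminar-hull` — stub GS2
# `stub_layeredPrisms` (prisms of a general layered set; the offset-torus analogue of `LayeredHull.cake_prisms`)

For `S = B '' {i • v₁(a) + j • v₂(a) + δ m + z m • e₃ : m i j ∈ ℤ}` — `B` a linear isometric equivalence of `ℝ³`,
bounded horizontal offsets (`(δ m) 2 = 0`, `‖δ m‖ ≤ D`), strictly increasing heights with gaps `≥ 3/4` — the prisms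
`W(m₁, n, K)` (layers `m₁ ≤ m < m₁ + n`, sites `0 ≤ x, y < K`) satisfy `W ⊆ S`, `#W = n K²` (the parametrisation
`(m, i, j) ↦ i • v₁ + j • v₂ + δ m + z m • e₃` is injective: third coordinate `z m`, then the two horizontal
coordinates determine `(i, j)`), and `∑_{p ∈ W} (1 + dist(p, S ∖ W))⁻³ ≤ 2 μ³ (n K + K²)`, `μ = (2D + 2)/κ`,
`κ = min (3/4) (a/4)`: a point of `S ∖ W` has indices outside the box, so for `p ∈ W` of index depth `d` it is
`≥ κ (d + 1) - 2D` away (`norm_ge_of_far`: vertical coordinate `≥ (3/4)(d + 1)` or a horizontal coordinate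
`≥ (a/4)(d + 1) - 2D`); `(1 + dist)⁻³ ≤ μ³/(d + 3)³` (`inv_cube_le_weight'`), and the six one-directional weight
families each sum to `≤ μ³/2` per line (`LayeredHull.cake_sum_weight_le`, `cake_sum_box_*`). Elementary. [folklore]
-/

noncomputable section

namespace Summit.AtomisticToContinuum.Crystallization.Theorems.PeriodicWindowsDenseLaminarHull

open Literature.MathematicalPhysics.StatisticalMechanics Filter Metric
open scoped BigOperators

/-! ## Coordinates of layered points -/

/-- First coordinate of `i • v₁ + j • v₂ + w + h • e₃`: `a i + a j / 2 + w 0`. [folklore] -/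
private theorem layerPt_apply_zero (a i j h : ℝ) (w : EuclideanSpace ℝ (Fin 3)) :
    (i • triangularVec₁ a + j • triangularVec₂ a + w + h • layerNormal 1) 0 = a * i + a / 2 * j + w 0 := by
  simp [triangularVec₁, triangularVec₂, layerNormal]
  ring

/-- Second coordinate of `i • v₁ + j • v₂ + w + h • e₃`: `a √3 j / 2 + w 1`. [folklore] -/
private theorem layerPt_apply_one (a i j h : ℝ) (w : EuclideanSpace ℝ (Fin 3)) :
    (i • triangularVec₁ a + j • triangularVec₂ a + w + h • layerNormal 1) 1 = a * √3 / 2 * j + w 1 := by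
  simp [triangularVec₁, triangularVec₂, layerNormal]
  ring

/-- Third coordinate of `i • v₁ + j • v₂ + w + h • e₃`: `w 2 + h`. [folklore] -/
private theorem layerPt_apply_two (a i j h : ℝ) (w : EuclideanSpace ℝ (Fin 3)) :
    (i • triangularVec₁ a + j • triangularVec₂ a + w + h • layerNormal 1) 2 = w 2 + h := by
  simp [triangularVec₁, triangularVec₂, layerNormal]

/-- Coordinates of differences of bounded offsets: `|(δ m) l - (δ m') l| ≤ 2D`. [folklore] -/
private theorem abs_coord_sub_le {D : ℝ} (δ : ℤ → EuclideanSpace ℝ (Fin 3)) (hδD : ∀ m : ℤ, ‖δ m‖ ≤ D)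
    (m m' : ℤ) (l : Fin 3) : |δ m l - δ m' l| ≤ 2 * D := by
  have h1 : |δ m l| ≤ ‖δ m‖ := by simpa using PiLp.norm_apply_le (δ m) l
  have h2 : |δ m' l| ≤ ‖δ m'‖ := by simpa using PiLp.norm_apply_le (δ m') l
  linarith [abs_sub (δ m l) (δ m' l), hδD m, hδD m']

/-! ## Far indices are far points -/

/-- **Far indices are far points (general offsets).** For a vector `V ∈ ℝ³` with horizontal coordinates
`V 0 = a X + a Y / 2 + e₀`, `V 1 = a √3 Y / 2 + e₁`, `|e₀|, |e₁| ≤ 2D`: if `T ≤ (4/3) |V 2|`, or `T ≤ |X|`, or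
`T ≤ |Y|`, then `κ T - 2 D ≤ ‖V‖` for every `κ ≤ min (3/4) (a/4)` (`T ≥ 0`, `a ≥ 0`, `D ≥ 0`). [folklore] -/
private theorem norm_ge_of_far (V : EuclideanSpace ℝ (Fin 3)) {a κ D X Y e₀ e₁ T : ℝ} (ha : 0 ≤ a)
    (hκ1 : κ ≤ 3 / 4) (hκa : κ ≤ a / 4) (hD : 0 ≤ D) (hT : 0 ≤ T)
    (h0 : V 0 = a * X + a / 2 * Y + e₀) (h1 : V 1 = a * √3 / 2 * Y + e₁)
    (he₀ : |e₀| ≤ 2 * D) (he₁ : |e₁| ≤ 2 * D)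
    (hcase : T ≤ 4 / 3 * |V 2| ∨ T ≤ |X| ∨ T ≤ |Y|) :
    κ * T - 2 * D ≤ ‖V‖ := by
  have hV0 : |V 0| ≤ ‖V‖ := by simpa using PiLp.norm_apply_le V 0
  have hV1 : |V 1| ≤ ‖V‖ := by simpa using PiLp.norm_apply_le V 1
  have hV2 : |V 2| ≤ ‖V‖ := by simpa using PiLp.norm_apply_le V 2
  have h3 : (1 : ℝ) ≤ √3 := Real.one_le_sqrt.2 (by norm_num)
  -- the second coordinate controls `|Y|`
  have hY : a / 2 * |Y| ≤ |V 1| + 2 * D := by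
    have e : a * √3 / 2 * Y = V 1 + -e₁ := by rw [h1]; ring
    have h := abs_add_le (V 1) (-e₁)
    rw [← e, abs_neg, abs_mul, abs_of_nonneg (by positivity : (0 : ℝ) ≤ a * √3 / 2)] at h
    have h' : a / 2 * |Y| ≤ a * √3 / 2 * |Y| := by
      apply mul_le_mul_of_nonneg_right _ (abs_nonneg _)
      nlinarith
    linarith
  -- the first coordinate controls `|X|` up to `|Y| / 2`
  have hX : a * |X| ≤ |V 0| + a / 2 * |Y| + 2 * D := by
    have e : a * X = V 0 + -(a / 2 * Y) + -e₀ := by rw [h0]; ring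
    have h := abs_add_three (V 0) (-(a / 2 * Y)) (-e₀)
    rw [← e, abs_neg, abs_neg, abs_mul, abs_of_nonneg ha, abs_mul,
      abs_of_nonneg (by positivity : (0 : ℝ) ≤ a / 2)] at h
    linarith
  have hκT : κ * T ≤ a / 4 * T := mul_le_mul_of_nonneg_right hκa hT
  rcases hcase with h | h | h
  · -- far layers: the vertical coordinate
    have h' : κ * T ≤ 3 / 4 * T := mul_le_mul_of_nonneg_right hκ1 hT
    linarith
  · -- far first index
    have h' : a / 4 * T ≤ a / 4 * |X| := mul_le_mul_of_nonneg_left h (by positivity)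
    rcases le_or_gt |X| (2 * |Y|) with hxy | hxy
    · have h'' : a / 4 * |X| ≤ a / 4 * (2 * |Y|) := mul_le_mul_of_nonneg_left hxy (by positivity)
      linarith
    · have h'' : a / 4 * (2 * |Y|) ≤ a / 4 * |X| := mul_le_mul_of_nonneg_left hxy.le (by positivity)
      have h''' : 0 ≤ a * |X| := by positivity
      linarith
  · -- far second index
    have h' : a / 4 * T ≤ a / 4 * |Y| := mul_le_mul_of_nonneg_left h (by positivity)
    have h'' : 0 ≤ a / 4 * |Y| := by positivity
    linarith

/-! ## Weights -/

/-- From the lower bounds `0 ≤ ρ` and `κ (T + 1) - 2D ≤ ρ` (`0 < κ ≤ 1`, `D, T ≥ 0`):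
`(1 + ρ)⁻¹ ³ ≤ ((2D + 2)/κ)³ / (T + 3)³`, since `(2D + 2)(1 + ρ) ≥ 2D + 2 + ρ ≥ κ (T + 3)`. [folklore] -/
private theorem inv_cube_le_weight' {ρ κ D T : ℝ} (hκ0 : 0 < κ) (hκ1 : κ ≤ 1) (hD : 0 ≤ D)
    (hρ0 : 0 ≤ ρ) (hρ : κ * (T + 1) - 2 * D ≤ ρ) (hT : 0 ≤ T) :
    (1 + ρ)⁻¹ ^ 3 ≤ ((2 * D + 2) / κ) ^ 3 / (T + 3) ^ 3 := by
  have h1 : κ * (T + 3) ≤ (2 * D + 2) * (1 + ρ) := by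
    nlinarith [mul_nonneg (by linarith : (0 : ℝ) ≤ 2 * D + 1) hρ0]
  have hpos : 0 < κ * (T + 3) / (2 * D + 2) := by positivity
  have h2 : κ * (T + 3) / (2 * D + 2) ≤ 1 + ρ := by
    rw [div_le_iff₀ (by positivity : (0 : ℝ) < 2 * D + 2)]
    linarith
  have h3 : (1 + ρ)⁻¹ ≤ (κ * (T + 3) / (2 * D + 2))⁻¹ := inv_anti₀ hpos h2
  have h4 : (0 : ℝ) ≤ (1 + ρ)⁻¹ := inv_nonneg.2 (by linarith)
  have hT3 : (0 : ℝ) < T + 3 := by linarith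
  calc (1 + ρ)⁻¹ ^ 3 ≤ ((κ * (T + 3) / (2 * D + 2))⁻¹) ^ 3 := pow_le_pow_left₀ h4 h3 3
    _ = ((2 * D + 2) / κ) ^ 3 / (T + 3) ^ 3 := by
        rw [inv_div]
        field_simp

/-- The scaled boundary weights `μ³/(k + 3)³` have partial sums `≤ μ³/2` (`LayeredHull.cake_sum_weight_le`).
[folklore] -/
private theorem sum_weight_le' (μ : ℝ) (hμ : 0 ≤ μ) (N : ℕ) :
    ∑ k ∈ Finset.range N, μ ^ 3 / ((k : ℝ) + 3) ^ 3 ≤ μ ^ 3 / 2 := by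
  have h := LayeredHull.cake_sum_weight_le N
  have e : ∑ k ∈ Finset.range N, μ ^ 3 / ((k : ℝ) + 3) ^ 3 =
      μ ^ 3 / 64 * ∑ k ∈ Finset.range N, (64 : ℝ) / ((k : ℝ) + 3) ^ 3 := by
    rw [Finset.mul_sum]
    refine Finset.sum_congr rfl fun k _ => ?_
    have hk : (0 : ℝ) < ((k : ℝ) + 3) ^ 3 := by positivity
    field_simp
  have h0 : 0 ≤ μ ^ 3 / 64 := by positivity
  rw [e]
  calc μ ^ 3 / 64 * ∑ k ∈ Finset.range N, (64 : ℝ) / ((k : ℝ) + 3) ^ 3 ≤ μ ^ 3 / 64 * 32 :=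
        mul_le_mul_of_nonneg_left h h0
    _ = μ ^ 3 / 2 := by ring

/-! ## The stub -/

/-- **GS2 (prisms of a general layered set; numerics-free, elementary).** For a general layered set
`S = B '' {i • v₁(a) + j • v₂(a) + δ m + z m • e₃}` with BOUNDED horizontal offsets `‖δ m‖ ≤ D` and strictly
increasing heights with gaps `≥ 3/4`, the prisms
`W(m₁, n, K) = {B (i • v₁ + j • v₂ + δ m + z m • e₃) : m ∈ [m₁, m₁+n), i, j ∈ [0, K)}` satisfy `W ⊆ S`, `#W = n K²`
(injective parametrisation: heights separate layers, `v₁, v₂` are independent) and the boundary functional of the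
window bounds is `Σ_{p ∈ W} (1 + dist(p, S ∖ W))⁻³ ≤ C (nK + K²)` with `C = C(a, D) = 2 ((2D + 2)/min (3/4) (a/4))³`
(see the module docstring; the weights are summed as in `LayeredHull.cake_prisms`). The hypothesis that `B`
preserves the third coordinate is not used (`B` drops out of all distances). [folklore] -/
theorem stub_layeredPrisms : ∀ a D : ℝ, 0 < a →
    ∀ (B : EuclideanSpace ℝ (Fin 3) ≃ₗᵢ[ℝ] EuclideanSpace ℝ (Fin 3)) (δ : ℤ → EuclideanSpace ℝ (Fin 3)) (z : ℤ → ℝ),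
    (∀ p : EuclideanSpace ℝ (Fin 3), (B p) 2 = p 2) → (∀ m : ℤ, (δ m) 2 = 0) → (∀ m : ℤ, ‖δ m‖ ≤ D) → StrictMono z →
    (∀ m : ℤ, (3 : ℝ) / 4 ≤ z (m + 1) - z m) →
    ∃ C : ℝ, ∀ (m₁ : ℤ) (n K : ℕ) (S : Set (EuclideanSpace ℝ (Fin 3))),
      S = (fun p => B p) '' {p | ∃ m i j : ℤ, p = ((i : ℝ) • triangularVec₁ a) +
        ((j : ℝ) • triangularVec₂ a) + δ m + (z m • layerNormal 1)} →
      ∀ W : Finset (EuclideanSpace ℝ (Fin 3)),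
      W = ((Finset.Ico m₁ (m₁ + n)) ×ˢ ((Finset.range K) ×ˢ (Finset.range K))).image
        (fun t : ℤ × (ℕ × ℕ) => B (((t.2.1 : ℝ) • triangularVec₁ a) + ((t.2.2 : ℝ) • triangularVec₂ a) +
          δ t.1 + (z t.1 • layerNormal 1))) →
      (↑W : Set (EuclideanSpace ℝ (Fin 3))) ⊆ S ∧ W.card = n * K ^ 2 ∧
      (∑ p ∈ W, (1 + Metric.infDist p (S \ (↑W : Set (EuclideanSpace ℝ (Fin 3)))))⁻¹ ^ 3) ≤ C * (n * K + K ^ 2) := by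
  intro a D ha B δ z _ hδ2 hδD hzmono hgap
  have hD0 : 0 ≤ D := (norm_nonneg _).trans (hδD 0)
  -- the constants
  obtain ⟨κ, hκ⟩ : ∃ κ : ℝ, κ = min (3 / 4) (a / 4) := ⟨_, rfl⟩
  have hκ0 : 0 < κ := by rw [hκ]; exact lt_min (by norm_num) (by linarith)
  have hκ1 : κ ≤ 3 / 4 := hκ ▸ min_le_left _ _
  have hκa : κ ≤ a / 4 := hκ ▸ min_le_right _ _
  obtain ⟨μ, hμ⟩ : ∃ μ : ℝ, μ = (2 * D + 2) / κ := ⟨_, rfl⟩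
  have hμ0 : 0 < μ := by rw [hμ]; positivity
  refine ⟨2 * μ ^ 3, ?_⟩
  intro m₁ n K S hS W hW
  -- heights: injective, `|z m' - z m| ≥ (3/4) |m' - m|` (`39/50 · 25/26 = 3/4`)
  have hzinj : Function.Injective z := hzmono.injective
  have hz' : ∀ m : ℤ, 39 / 50 * (25 / 26 : ℝ) ≤ z (m + 1) - z m := fun m => by
    have := hgap m
    norm_num
    linarith
  have hzdiff : ∀ m m' : ℤ, 3 / 4 * |((m' : ℝ) - m)| ≤ |z m' - z m| := fun m m' => by
    have h := LayeredHull.cake_abs_height_diff_ge (25 / 26) (by norm_num) z hz' m m'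
    norm_num at h
    exact h
  -- the layered points and the parametrisation of the prism
  obtain ⟨Q, hQ⟩ : ∃ Q : ℤ → ℤ → ℤ → EuclideanSpace ℝ (Fin 3), ∀ m i j : ℤ, Q m i j =
      ((i : ℝ) • triangularVec₁ a) + ((j : ℝ) • triangularVec₂ a) + δ m + (z m • layerNormal 1) :=
    ⟨_, fun _ _ _ => rfl⟩
  set P : ℤ × (ℕ × ℕ) → EuclideanSpace ℝ (Fin 3) := fun t : ℤ × (ℕ × ℕ) =>
    B (((t.2.1 : ℝ) • triangularVec₁ a) + ((t.2.2 : ℝ) • triangularVec₂ a) +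
      δ t.1 + (z t.1 • layerNormal 1)) with hP
  subst hW
  have hPt : ∀ (m : ℤ) (x y : ℕ), P (m, (x, y)) = B (Q m x y) := by
    intro m x y
    simp only [hP, hQ, Int.cast_natCast]
  -- coordinates
  have hQ0 : ∀ m i j : ℤ, Q m i j 0 = a * i + a / 2 * j + δ m 0 := fun m i j => by
    rw [hQ, layerPt_apply_zero]
  have hQ1 : ∀ m i j : ℤ, Q m i j 1 = a * √3 / 2 * j + δ m 1 := fun m i j => by
    rw [hQ, layerPt_apply_one]
  have hQ2 : ∀ m i j : ℤ, Q m i j 2 = z m := fun m i j => by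
    rw [hQ, layerPt_apply_two, hδ2, zero_add]
  -- injectivity of the parametrisation of `S`
  have hinjQ : ∀ {m i j m' i' j' : ℤ}, Q m i j = Q m' i' j' → m = m' ∧ i = i' ∧ j = j' := by
    intro m i j m' i' j' h
    have e2 := congrArg (fun v : EuclideanSpace ℝ (Fin 3) => v 2) h
    have e1 := congrArg (fun v : EuclideanSpace ℝ (Fin 3) => v 1) h
    have e0 := congrArg (fun v : EuclideanSpace ℝ (Fin 3) => v 0) h
    simp only [hQ2] at e2
    obtain rfl : m = m' := hzinj e2
    simp only [hQ1, hQ0, add_left_inj] at e0 e1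
    have hj : (j : ℝ) = j' := mul_left_cancel₀ (by positivity : a * √3 / 2 ≠ 0) e1
    rw [hj, add_left_inj] at e0
    have hi : (i : ℝ) = i' := mul_left_cancel₀ ha.ne' e0
    exact ⟨rfl, by exact_mod_cast hi, by exact_mod_cast hj⟩
  have hinjP : Function.Injective P := by
    rintro ⟨m, x, y⟩ ⟨m', x', y'⟩ h
    rw [hPt, hPt] at h
    obtain ⟨h1, h2, h3⟩ := hinjQ (B.injective h)
    subst h1
    have h2' : x = x' := by exact_mod_cast h2
    have h3' : y = y' := by exact_mod_cast h3
    rw [h2', h3']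
  -- `S` is parametrised by `Q`
  have hQS : ∀ m i j : ℤ, B (Q m i j) ∈ S := fun m i j => by
    rw [hS]
    exact ⟨Q m i j, ⟨m, i, j, hQ m i j⟩, rfl⟩
  have hPS : ∀ t, P t ∈ S := by
    rintro ⟨m, x, y⟩
    rw [hPt]
    exact hQS m x y
  have hSQ : ∀ q ∈ S, ∃ m i j : ℤ, q = B (Q m i j) := by
    intro q hq
    rw [hS] at hq
    obtain ⟨p, ⟨m, i, j, hp⟩, rfl⟩ := hq
    exact ⟨m, i, j, by rw [hp, hQ]⟩
  refine ⟨?_, ?_, ?_⟩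
  · -- `W ⊆ S`
    intro p hp
    rw [Finset.mem_coe, Finset.mem_image] at hp
    obtain ⟨t, -, rfl⟩ := hp
    exact hPS t
  · -- `#W = n K²`
    rw [Finset.card_image_of_injective _ hinjP, Finset.card_product, Finset.card_product,
      Finset.card_range, Int.card_Ico]
    have hI : (m₁ + (n : ℤ) - m₁).toNat = n := by simp
    rw [hI]
    ring
  · -- the boundary sum
    rw [Finset.sum_image fun t _ t' _ h => hinjP h]
    set Bw : ℕ → ℝ := fun k => μ ^ 3 / ((k : ℝ) + 3) ^ 3 with hBw
    have hBw0 : ∀ k, 0 ≤ Bw k := fun k => by positivity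
    -- a point of `S` outside the prism
    have hne : (S \ ↑((Finset.Ico m₁ (m₁ + n) ×ˢ (Finset.range K ×ˢ Finset.range K)).image P)).Nonempty := by
      refine ⟨B (Q (m₁ - 1) 0 0), hQS _ _ _, ?_⟩
      intro hmem
      rw [Finset.mem_coe, Finset.mem_image] at hmem
      obtain ⟨⟨m', x', y'⟩, ht', heq⟩ := hmem
      rw [hPt] at heq
      obtain ⟨h1, -, -⟩ := hinjQ (B.injective heq)
      simp only [Finset.mem_product, Finset.mem_Ico] at ht'
      omega
    -- the per-point bound
    have hpt : ∀ t ∈ Finset.Ico m₁ (m₁ + n) ×ˢ (Finset.range K ×ˢ Finset.range K),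
        (1 + Metric.infDist (P t)
          (S \ ↑((Finset.Ico m₁ (m₁ + n) ×ˢ (Finset.range K ×ˢ Finset.range K)).image P)))⁻¹ ^ 3 ≤
        Bw t.2.1 + Bw (K - 1 - t.2.1) + Bw t.2.2 + Bw (K - 1 - t.2.2) + Bw (t.1 - m₁).toNat +
          Bw (m₁ + n - 1 - t.1).toNat := by
      rintro ⟨m, x, y⟩ ht
      simp only [Finset.mem_product, Finset.mem_Ico, Finset.mem_range] at ht
      obtain ⟨⟨hm1, hm2⟩, hx, hy⟩ := ht
      dsimp only
      set dmin : ℕ := min (min x (K - 1 - x)) (min (min y (K - 1 - y))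
        (min (m - m₁).toNat (m₁ + n - 1 - m).toNat)) with hdmin
      have hd1 : dmin ≤ x := (min_le_left _ _).trans (min_le_left _ _)
      have hd2 : dmin ≤ K - 1 - x := (min_le_left _ _).trans (min_le_right _ _)
      have hd3 : dmin ≤ y := (min_le_right _ _).trans ((min_le_left _ _).trans (min_le_left _ _))
      have hd4 : dmin ≤ K - 1 - y := (min_le_right _ _).trans ((min_le_left _ _).trans (min_le_right _ _))
      have hd5 : dmin ≤ (m - m₁).toNat := (min_le_right _ _).trans ((min_le_right _ _).trans (min_le_left _ _))
      have hd6 : dmin ≤ (m₁ + n - 1 - m).toNat :=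
        (min_le_right _ _).trans ((min_le_right _ _).trans (min_le_right _ _))
      have hinf : κ * ((dmin : ℝ) + 1) - 2 * D ≤ Metric.infDist (P (m, (x, y)))
          (S \ ↑((Finset.Ico m₁ (m₁ + n) ×ˢ (Finset.range K ×ˢ Finset.range K)).image P)) := by
        refine (Metric.le_infDist hne).2 fun q hq => ?_
        obtain ⟨hqS, hqW⟩ := hq
        obtain ⟨m', i', j', rfl⟩ := hSQ q hqS
        have hbox : ¬ (m₁ ≤ m' ∧ m' < m₁ + n ∧ 0 ≤ i' ∧ i' < K ∧ 0 ≤ j' ∧ j' < K) := by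
          rintro ⟨h1, h2, h3, h4, h5, h6⟩
          apply hqW
          rw [Finset.mem_coe, Finset.mem_image]
          refine ⟨(m', (i'.toNat, j'.toNat)), ?_, ?_⟩
          · simp only [Finset.mem_product, Finset.mem_Ico, Finset.mem_range]
            omega
          · rw [hPt, Int.toNat_of_nonneg h3, Int.toNat_of_nonneg h5]
        have hcase : (dmin : ℤ) + 1 ≤ |m' - m| ∨ (dmin : ℤ) + 1 ≤ |i' - (x : ℤ)| ∨
            (dmin : ℤ) + 1 ≤ |j' - (y : ℤ)| := by
          by_cases c1 : m' < m₁
          · exact Or.inl (le_abs.2 (Or.inr (by omega)))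
          by_cases c2 : m₁ + n ≤ m'
          · exact Or.inl (le_abs.2 (Or.inl (by omega)))
          by_cases c3 : i' < 0
          · exact Or.inr (Or.inl (le_abs.2 (Or.inr (by omega))))
          by_cases c4 : (K : ℤ) ≤ i'
          · exact Or.inr (Or.inl (le_abs.2 (Or.inl (by omega))))
          by_cases c5 : j' < 0
          · exact Or.inr (Or.inr (le_abs.2 (Or.inr (by omega))))
          by_cases c6 : (K : ℤ) ≤ j'
          · exact Or.inr (Or.inr (le_abs.2 (Or.inl (by omega))))
          exact absurd ⟨by omega, by omega, by omega, by omega, by omega, by omega⟩ hbox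
        rw [hPt, LinearIsometryEquiv.dist_map, dist_eq_norm]
        refine norm_ge_of_far (Q m x y - Q m' i' j') (X := (x : ℝ) - i') (Y := (y : ℝ) - j')
          (e₀ := δ m 0 - δ m' 0) (e₁ := δ m 1 - δ m' 1) ha.le hκ1 hκa hD0 (by positivity) ?_ ?_
          (abs_coord_sub_le δ hδD m m' 0) (abs_coord_sub_le δ hδD m m' 1) ?_
        · rw [PiLp.sub_apply, hQ0, hQ0]
          push_cast
          ring
        · rw [PiLp.sub_apply, hQ1, hQ1]
          push_cast
          ring
        · rcases hcase with h | h | h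
          · refine Or.inl ?_
            have h' : (dmin : ℝ) + 1 ≤ |((m' : ℝ) - m)| := by exact_mod_cast h
            have h2 := hzdiff m m'
            rw [PiLp.sub_apply, hQ2, hQ2, abs_sub_comm]
            linarith
          · refine Or.inr (Or.inl ?_)
            rw [abs_sub_comm]
            exact_mod_cast h
          · refine Or.inr (Or.inr ?_)
            rw [abs_sub_comm]
            exact_mod_cast h
      have hw : (1 + Metric.infDist (P (m, (x, y)))
          (S \ ↑((Finset.Ico m₁ (m₁ + n) ×ˢ (Finset.range K ×ˢ Finset.range K)).image P)))⁻¹ ^ 3 ≤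
          μ ^ 3 / ((dmin : ℝ) + 3) ^ 3 := by
        have h := inv_cube_le_weight' hκ0 (by linarith) hD0 Metric.infDist_nonneg hinf (Nat.cast_nonneg dmin)
        rwa [← hμ] at h
      exact hw.trans (LayeredHull.cake_weight_min_le Bw hBw0 _ _ _ _ _ _)
    -- summing the per-point bounds
    have e1 : ∑ t ∈ Finset.Ico m₁ (m₁ + n) ×ˢ (Finset.range K ×ˢ Finset.range K), Bw t.2.1 =
        n * (K * ∑ x ∈ Finset.range K, Bw x) := LayeredHull.cake_sum_box_fst Bw m₁ n K
    have e2 : ∑ t ∈ Finset.Ico m₁ (m₁ + n) ×ˢ (Finset.range K ×ˢ Finset.range K), Bw (K - 1 - t.2.1) =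
        n * (K * ∑ x ∈ Finset.range K, Bw (K - 1 - x)) :=
      LayeredHull.cake_sum_box_fst (fun x => Bw (K - 1 - x)) m₁ n K
    have e3 : ∑ t ∈ Finset.Ico m₁ (m₁ + n) ×ˢ (Finset.range K ×ˢ Finset.range K), Bw t.2.2 =
        n * (K * ∑ y ∈ Finset.range K, Bw y) := LayeredHull.cake_sum_box_snd Bw m₁ n K
    have e4 : ∑ t ∈ Finset.Ico m₁ (m₁ + n) ×ˢ (Finset.range K ×ˢ Finset.range K), Bw (K - 1 - t.2.2) =
        n * (K * ∑ y ∈ Finset.range K, Bw (K - 1 - y)) :=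
      LayeredHull.cake_sum_box_snd (fun y => Bw (K - 1 - y)) m₁ n K
    have e5 : ∑ t ∈ Finset.Ico m₁ (m₁ + n) ×ˢ (Finset.range K ×ˢ Finset.range K), Bw (t.1 - m₁).toNat =
        (K : ℝ) ^ 2 * ∑ m ∈ Finset.Ico m₁ (m₁ + n), Bw (m - m₁).toNat :=
      LayeredHull.cake_sum_box_layer (fun m => Bw (m - m₁).toNat) m₁ n K
    have e6 : ∑ t ∈ Finset.Ico m₁ (m₁ + n) ×ˢ (Finset.range K ×ˢ Finset.range K),
        Bw (m₁ + n - 1 - t.1).toNat =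
        (K : ℝ) ^ 2 * ∑ m ∈ Finset.Ico m₁ (m₁ + n), Bw (m₁ + n - 1 - m).toNat :=
      LayeredHull.cake_sum_box_layer (fun m => Bw (m₁ + n - 1 - m).toNat) m₁ n K
    have s1 : ∑ x ∈ Finset.range K, Bw x ≤ μ ^ 3 / 2 := sum_weight_le' μ hμ0.le K
    have s2 : ∑ x ∈ Finset.range K, Bw (K - 1 - x) ≤ μ ^ 3 / 2 := by
      rw [Finset.sum_range_reflect Bw K]
      exact sum_weight_le' μ hμ0.le K
    have s5 : ∑ m ∈ Finset.Ico m₁ (m₁ + n), Bw (m - m₁).toNat ≤ μ ^ 3 / 2 := by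
      rw [LayeredHull.cake_sum_Ico_eq_sum_range]
      have : ∀ k ∈ Finset.range n, Bw (m₁ + (k : ℤ) - m₁).toNat = Bw k := fun k _ => by
        congr 1
        omega
      rw [Finset.sum_congr rfl this]
      exact sum_weight_le' μ hμ0.le n
    have s6 : ∑ m ∈ Finset.Ico m₁ (m₁ + n), Bw (m₁ + n - 1 - m).toNat ≤ μ ^ 3 / 2 := by
      rw [LayeredHull.cake_sum_Ico_eq_sum_range]
      have : ∀ k ∈ Finset.range n, Bw (m₁ + n - 1 - (m₁ + (k : ℤ))).toNat = Bw (n - 1 - k) := fun k hk => by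
        congr 1
        have := Finset.mem_range.1 hk
        omega
      rw [Finset.sum_congr rfl this, Finset.sum_range_reflect Bw n]
      exact sum_weight_le' μ hμ0.le n
    have hn : (0 : ℝ) ≤ n := Nat.cast_nonneg n
    have hK : (0 : ℝ) ≤ K := Nat.cast_nonneg K
    have hμK : (0 : ℝ) ≤ (K : ℝ) ^ 2 * μ ^ 3 := by positivity
    calc ∑ t ∈ Finset.Ico m₁ (m₁ + n) ×ˢ (Finset.range K ×ˢ Finset.range K), (1 + Metric.infDist (P t)
          (S \ ↑((Finset.Ico m₁ (m₁ + n) ×ˢ (Finset.range K ×ˢ Finset.range K)).image P)))⁻¹ ^ 3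
        ≤ ∑ t ∈ Finset.Ico m₁ (m₁ + n) ×ˢ (Finset.range K ×ˢ Finset.range K),
            (Bw t.2.1 + Bw (K - 1 - t.2.1) + Bw t.2.2 + Bw (K - 1 - t.2.2) + Bw (t.1 - m₁).toNat +
              Bw (m₁ + n - 1 - t.1).toNat) := Finset.sum_le_sum hpt
      _ = n * (K * ∑ x ∈ Finset.range K, Bw x) + n * (K * ∑ x ∈ Finset.range K, Bw (K - 1 - x)) +
            n * (K * ∑ y ∈ Finset.range K, Bw y) + n * (K * ∑ y ∈ Finset.range K, Bw (K - 1 - y)) +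
            (K : ℝ) ^ 2 * ∑ m ∈ Finset.Ico m₁ (m₁ + n), Bw (m - m₁).toNat +
            (K : ℝ) ^ 2 * ∑ m ∈ Finset.Ico m₁ (m₁ + n), Bw (m₁ + n - 1 - m).toNat := by
          simp only [Finset.sum_add_distrib]
          rw [e1, e2, e3, e4, e5, e6]
      _ ≤ n * (K * (μ ^ 3 / 2)) + n * (K * (μ ^ 3 / 2)) + n * (K * (μ ^ 3 / 2)) + n * (K * (μ ^ 3 / 2)) +
            (K : ℝ) ^ 2 * (μ ^ 3 / 2) + (K : ℝ) ^ 2 * (μ ^ 3 / 2) := by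
          gcongr
      _ ≤ 2 * μ ^ 3 * (n * K + K ^ 2) := by nlinarith [mul_nonneg hn hK, hμK]

end Summit.AtomisticToContinuum.Crystallization.Theorems.PeriodicWindowsDenseLaminarHull

end
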